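import Summits.QuantumFields.BalabanUV.T4Continuum.Support.NE7K1LinSchurFoldBox

/-!
# NE7K1LinSchurFoldForms — row NE7 (node U5), candidate route HOM, path H1L, cell K1-lin(s): QUADRATIC FORMS TRANSFER THROUGH THE
# FOLD — `E_cᵀE_c = 2^{d+1}·1`, the box line's form is the torus line's form on fold-symmetric vectors, Löwner floors descend
# (NEEDS-ESTIMATE #E1, input I2 — form-level corollaries)

Lineage `b2b-balaban-t4-ne7-p2` (CRUX PROVER NE7 #2), generation 72; file 35 (corollaries of file 34 `NE7K1LinSchurFoldBox`).

* `form_transfer` ∕ `coercive_transfer` (abstract): an intertwining `X′E_c = E_cX` with `E_cᵀE_c = c·1`, `c > 0`, gives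
  `⟨E_cV, X′E_cV⟩ = c·⟨V, XV⟩`, so every coercivity floor of `X′` is one of `X`.
* **`unfoldM_transpose_mul_unfoldM`**: `E_cᵀE_c = 2^{d+1}·1` for the unfold matrix of the doubled torus over the box (each box label has
  exactly `2^{d+1}` torus labels over it — file 34's `card_fibre` — and distinct labels have disjoint fibres).
* **`form_twoCutoffLine_eq`**: `⟨E_cV, T^𝕋(s)·E_cV⟩ = 2^{d+1}·⟨V, T^Π(s)·V⟩` for every `s`, `a ≥ 0`; **`coercive_twoCutoffLine_of_torLine`**:
  every Löwner floor of the torus line is a floor of the Neumann-box line — torus-side (translation-invariant, symbol-level) lower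
  bounds for `σ_s` reach the box with no loss, which is how #E1's class-S facts (B-E1) are meant to be consumed on boxes.

HONEST FRAMING: [folklore]; finite identities, NO estimate of Bałaban's; no `sorry`.  Census only (I2's form-level corollaries);
NE7 NOT PRINTED ∕ NOT PROVED; spine 0∕9; FIXED FINITE T⁴, rung (B)+1; NOT infinite volume, NOT mass gap, NOT Clay.  HONEST
DEPENDENCY: continuum YM on T⁴ ⇐ BetaPertH ∧ nine spine estimates (0/9 proved); BetaPertH ⇐ (D1) ∧ (D4) ∧ CAP+tail; G-an2-4
gates asym, D1 and NE2/3/4.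
-/

noncomputable section

open Finset Matrix

namespace Summit.QuantumFields.BalabanUV.T4Continuum.NE7K1LinSchurFoldForms

open Literature.MathematicalPhysics.QuantumFieldTheory.Balaban1983to89
open Literature.MathematicalPhysics.QuantumFieldTheory.Balaban1983to89.B4Reflection242
open Literature.MathematicalPhysics.QuantumFieldTheory.Balaban1983to89.B4Lower18
open NE7K1LinFoldKernels NE7K1LinFoldMatrices NE7K1LinSchurFold NE7K1LinTorusChart NE7K1LinSchurFoldBox NE7K1LinBlockCoords
  NE7K1LinSchurLineU1 NE7K1LinSchurLineForm

variable {d : ℕ}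

/-! ### §1 Abstract transfer; §2 `E_cᵀE_c = 2^{d+1}·1`; §3 the line -/

section Forms

/-- forms transfer through an intertwining with `E_cᵀE_c = c·1`: `⟨E_cV, X′E_cV⟩ = c·⟨V, XV⟩`. [folklore] -/
theorem form_transfer {κ κ' : Type*} [Fintype κ] [Fintype κ'] [DecidableEq κ] {X : Matrix κ κ ℝ} {X' : Matrix κ' κ' ℝ}
    {Ec : Matrix κ' κ ℝ} {c : ℝ} (h : X' * Ec = Ec * X) (hEE : Ecᵀ * Ec = c • (1 : Matrix κ κ ℝ)) (V : κ → ℝ) :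
    (Ec *ᵥ V) ⬝ᵥ X' *ᵥ (Ec *ᵥ V) = c * (V ⬝ᵥ X *ᵥ V) := by
  rw [Matrix.mulVec_mulVec, h, ← Matrix.mulVec_mulVec, Matrix.dotProduct_mulVec (Ec *ᵥ V) Ec, ← Matrix.mulVec_transpose,
    Matrix.mulVec_mulVec, hEE, Matrix.smul_mulVec, Matrix.one_mulVec, smul_dotProduct, smul_eq_mul]

/-- **LÖWNER BOUNDS DESCEND THROUGH THE FOLD**: a coercivity floor of `X′` is a floor of `X` (`E_cᵀE_c = c·1`, `c > 0`). [folklore] -/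
theorem coercive_transfer {κ κ' : Type*} [Fintype κ] [Fintype κ'] [DecidableEq κ] [DecidableEq κ'] {X : Matrix κ κ ℝ}
    {X' : Matrix κ' κ' ℝ}
    {Ec : Matrix κ' κ ℝ} {c : ℝ} (h : X' * Ec = Ec * X) (hEE : Ecᵀ * Ec = c • (1 : Matrix κ κ ℝ)) (hc : 0 < c) {σ : ℝ}
    (hX' : ∀ W : κ' → ℝ, σ * (W ⬝ᵥ W) ≤ W ⬝ᵥ X' *ᵥ W) (V : κ → ℝ) : σ * (V ⬝ᵥ V) ≤ V ⬝ᵥ X *ᵥ V := by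
  have h1 := hX' (Ec *ᵥ V)
  have h2 : (Ec *ᵥ V) ⬝ᵥ (1 : Matrix κ' κ' ℝ) *ᵥ (Ec *ᵥ V) = c * (V ⬝ᵥ (1 : Matrix κ κ ℝ) *ᵥ V) :=
    form_transfer (by rw [Matrix.one_mul, Matrix.mul_one]) hEE V
  rw [Matrix.one_mulVec, Matrix.one_mulVec] at h2
  rw [form_transfer h hEE, h2] at h1
  have h3 : σ * (V ⬝ᵥ V) * c ≤ (V ⬝ᵥ X *ᵥ V) * c := by nlinarith
  exact le_of_mul_le_mul_right h3 hc

variable {n L : ℕ} [NeZero L] {M : Fin (d + 1) → ℕ}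

/-- **`E_cᵀ·E_c = 2^{d+1}·1`**: every box label has exactly `2^{d+1}` torus labels over it, and distinct box labels have disjoint
fibres. [folklore] -/
theorem unfoldM_transpose_mul_unfoldM (hn : 1 ≤ n) (hM : ∀ i, 1 ≤ M i) :
    (unfoldM (fun i => n * M i) ((boxDom (dbl fun i => n * L * M i)).image (blk L))
        ((boxDom fun i => n * L * M i).image (blk L)))ᵀ *
      unfoldM (fun i => n * M i) ((boxDom (dbl fun i => n * L * M i)).image (blk L))
        ((boxDom fun i => n * L * M i).image (blk L)) =
    (2 : ℝ) ^ (d + 1) • (1 : Matrix ↥((boxDom fun i => n * L * M i).image (blk L))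
      ↥((boxDom fun i => n * L * M i).image (blk L)) ℝ) := by
  classical
  have hL : 1 ≤ L := NeZero.one_le
  have hNc : ∀ i, 1 ≤ (fun i => n * M i) i := mul_pos_side hn hM
  ext y y'
  rw [Matrix.mul_apply, Matrix.smul_apply, Matrix.one_apply]
  simp only [Matrix.transpose_apply, unfoldM_apply]
  by_cases hyy : y = y'
  · subst hyy
    have e1 : ∀ x : ↥((boxDom (dbl fun i => n * L * M i)).image (blk L)),
        (if foldBox (fun i => n * M i) x.1 = y.1 then (1 : ℝ) else 0) *
            (if foldBox (fun i => n * M i) x.1 = y.1 then (1 : ℝ) else 0) =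
          if foldBox (fun i => n * M i) x.1 = y.1 then 1 else 0 := fun x => by split_ifs <;> simp
    rw [Finset.sum_congr rfl fun x _ => e1 x]
    have h := sum_coe_ite (F := (boxDom (dbl fun i => n * L * M i)).image (blk L))
      (fun z => foldBox (fun i => n * M i) z = y.1) (1 : ℝ)
    have hy : y.1 ∈ boxDom (fun i => n * M i) := by
      have h2 := y.2
      simp only [image_fineBox hL n M] at h2
      exact h2
    conv at h => rhs; rw [image_fineTor hL n M, card_fibre hNc hy]
    refine h.trans ?_
    simp
  · have e1 : ∀ x : ↥((boxDom (dbl fun i => n * L * M i)).image (blk L)),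
        (if foldBox (fun i => n * M i) x.1 = y.1 then (1 : ℝ) else 0) *
            (if foldBox (fun i => n * M i) x.1 = y'.1 then (1 : ℝ) else 0) = 0 := by
      intro x
      by_cases h1 : foldBox (fun i => n * M i) x.1 = y.1
      · have h2 : foldBox (fun i => n * M i) x.1 ≠ y'.1 := fun h2 => hyy (Subtype.ext (h1.symm.trans h2))
        simp [h2]
      · simp [h1]
    rw [Finset.sum_congr rfl fun x _ => e1 x, Finset.sum_const_zero, if_neg hyy, smul_zero]

/-- **THE BOX LINE's QUADRATIC FORM IS THE TORUS LINE's ON FOLD-SYMMETRIC VECTORS**: `⟨E_cV, torLine(s)·E_cV⟩ =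
2^{d+1}·⟨V, twoCutoffLine(s)·V⟩` for every `s`, `a ≥ 0`. [folklore] -/
theorem form_twoCutoffLine_eq (hn : 1 ≤ n) {a : ℝ} (ha : 0 ≤ a) (hM : ∀ i, 1 ≤ M i) (s : ℝ)
    (V : ↥((boxDom fun i => n * L * M i).image (blk L)) → ℝ) :
    (unfoldM (fun i => n * M i) ((boxDom (dbl fun i => n * L * M i)).image (blk L))
          ((boxDom fun i => n * L * M i).image (blk L)) *ᵥ V) ⬝ᵥ
        torLine (isBlockUnion_fine (fineTor_isBlockUnion hn (NeZero.one_le : 1 ≤ L) M)) n a (fun i => n * L * M i)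
          (fun i => n * M i) s *ᵥ
        (unfoldM (fun i => n * M i) ((boxDom (dbl fun i => n * L * M i)).image (blk L))
          ((boxDom fun i => n * L * M i).image (blk L)) *ᵥ V) =
      (2 : ℝ) ^ (d + 1) * (V ⬝ᵥ twoCutoffLine (isBlockUnion_fine (fineBox_isBlockUnion hn (NeZero.one_le : 1 ≤ L) M)) n a s *ᵥ V) :=
  form_transfer (torLine_mul_unfoldM hn ha hM s) (unfoldM_transpose_mul_unfoldM hn hM) V

/-- **COERCIVITY DESCENDS**: every floor `σ` of the torus line is a floor of the box line (same `s`, `a ≥ 0`). [folklore] -/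
theorem coercive_twoCutoffLine_of_torLine (hn : 1 ≤ n) {a : ℝ} (ha : 0 ≤ a) (hM : ∀ i, 1 ≤ M i) (s : ℝ) {σ : ℝ}
    (hσ : ∀ W : ↥((boxDom (dbl fun i => n * L * M i)).image (blk L)) → ℝ, σ * (W ⬝ᵥ W) ≤
      W ⬝ᵥ torLine (isBlockUnion_fine (fineTor_isBlockUnion hn (NeZero.one_le : 1 ≤ L) M)) n a (fun i => n * L * M i)
        (fun i => n * M i) s *ᵥ W)
    (V : ↥((boxDom fun i => n * L * M i).image (blk L)) → ℝ) :
    σ * (V ⬝ᵥ V) ≤ V ⬝ᵥ twoCutoffLine (isBlockUnion_fine (fineBox_isBlockUnion hn (NeZero.one_le : 1 ≤ L) M)) n a s *ᵥ V :=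
  coercive_transfer (torLine_mul_unfoldM hn ha hM s) (unfoldM_transpose_mul_unfoldM hn hM) (by positivity) hσ V

end Forms

end Summit.QuantumFields.BalabanUV.T4Continuum.NE7K1LinSchurFoldForms

end
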